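import Mathlib
import Summits.Ventures.PercRepro2.Defs
import Summits.Ventures.PercRepro2.Independence
import Summits.Ventures.PercRepro2.Harris
import Summits.Ventures.PercRepro2.Graph
import Summits.Ventures.PercRepro2.Events
import Summits.Ventures.PercRepro2.Induced
import Summits.Ventures.PercRepro2.Frontier
import Summits.Ventures.PercRepro2.ObsIndependence
import Summits.Ventures.PercRepro2.BHKAntitone
import Summits.Ventures.PercRepro2.BHKAntitoneCross
import Summits.Ventures.PercRepro2.BTVFamilyDefs
import Summits.Ventures.PercRepro2.BTVFamilyTower

/-!
# The merged V-family behind (B-T): the base case (blind cell PercRepro2, mine-1 g52;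
paper proofs/MINE1-BT.md §2.5, case `Z = ∅`)

When the frontier sets of the two left-hand cells are disjoint, the V-family inequality is the
two-cluster four-functions corollary `bhk_two_cluster_four'` of the antitone BHK theorem
(explored root `t`), applied to the whole graph with the edges outside `U` pinned closed: the
cells `a, b` are contained in the corollary's left-hand events (`C_t` hits `W₁` / contains `v`,
`C_s` contains `v` / hits `A₂` and avoids `A₁ ∪ W₁` / `W₂`, `t` avoids `A₁ ∪ {s, v}` /
`A₂ ∪ W₂ ∪ {s}`), and its right-hand events are contained in `m(∅, W₁ ∪ W₂)` and
`j(A₁ ∪ A₂, ∅)` — the lost avoidances are harmless because `A₁ ∩ A₂ = W₁ ∩ W₂ = ∅`.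
-/

namespace Summit.Ventures.PercRepro2

namespace BTVFamily

section Base

variable {V : Type*} {E : Type*} [Fintype E] [DecidableEq E] [Fintype V] [DecidableEq V]
  {R : Type*} [CommRing R] [LinearOrder R] [IsStrictOrderedRing R]

/-! ### The base case: the frontiers of the two sides are disjoint -/

omit [Fintype E] [DecidableEq E] [Fintype V] in
/-- `a` on `G[U]` is the whole-graph cell evaluated on the induced configuration. -/
lemma aEv_eq_induced_mem (ends : E → Sym2 V) (U : Finset V) (s t v : V) (A W : Finset V) :
    aEv ends U s t v A W =
      {ω | induced ends (↑U) ω ∈ ({ω | aProp ends s t v A W ω} : Set (Config E))} := rfl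

omit [Fintype E] [DecidableEq E] [Fintype V] in
/-- `b` on `G[U]` is the whole-graph cell evaluated on the induced configuration. -/
lemma bEv_eq_induced_mem (ends : E → Sym2 V) (U : Finset V) (s t v : V) (A W : Finset V) :
    bEv ends U s t v A W =
      {ω | induced ends (↑U) ω ∈ ({ω | bProp ends s t v A W ω} : Set (Config E))} := rfl

omit [Fintype E] [DecidableEq E] [Fintype V] in
/-- `j` on `G[U]` is the whole-graph cell evaluated on the induced configuration. -/
lemma jEv_eq_induced_mem (ends : E → Sym2 V) (U : Finset V) (s t v : V) (A W : Finset V) :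
    jEv ends U s t v A W =
      {ω | induced ends (↑U) ω ∈ ({ω | jProp ends s t v A W ω} : Set (Config E))} := rfl

omit [Fintype E] [DecidableEq E] [Fintype V] in
/-- `m` on `G[U]` is the whole-graph cell evaluated on the induced configuration. -/
lemma mEv_eq_induced_mem (ends : E → Sym2 V) (U : Finset V) (s t v : V) (A W : Finset V) :
    mEv ends U s t v A W =
      {ω | induced ends (↑U) ω ∈ ({ω | mProp ends s t v A W ω} : Set (Config E))} := rfl

omit [Fintype E] [DecidableEq E] [Fintype V] in
/-- (I1) `a(A₁,W₁)` is contained in the first left-hand event of the two-cluster corollary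
(explored root `t`): `C_t` hits `W₁`, `C_s` contains `v` and avoids `A₁ ∪ W₁`, `t` avoids
`A₁ ∪ {s, v}`. -/
lemma aProp_subset (ends : E → Sym2 V) (s t v : V) (A₁ W₁ : Finset V) :
    ({ω | aProp ends s t v A₁ W₁ ω} : Set (Config E)) ⊆
      clusterInEvent ends t {L | ∃ y ∈ W₁, y ∈ L} ∩
        clusterInEvent ends s ({K | v ∈ K} ∩ {K | ∀ x ∈ A₁ ∪ W₁, x ∉ K}) ∩
          avoidAll ends t (A₁ ∪ {s, v}) := by
  rintro ω ⟨h1, h2, h3, h4, _⟩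
  have hst : ¬ Conn ends ω s t := fun h =>
    h3 ⟨s, Finset.mem_singleton_self s, t,
      Finset.mem_union_left _ (Finset.mem_union_left _ (Finset.mem_singleton_self t)), h⟩
  refine ⟨⟨?_, ?_, ?_⟩, ?_⟩
  · obtain ⟨y, hy, hty⟩ := connSet_singleton_left.1 h2
    exact ⟨y, hy, hty⟩
  · exact conn_symm h1
  · intro x hx hsx
    refine h3 ⟨s, Finset.mem_singleton_self s, x, ?_, hsx⟩
    rw [Finset.union_assoc]
    exact Finset.mem_union_right _ hx
  · intro x hx htx
    rcases Finset.mem_union.1 hx with hx | hx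
    · exact h4 ⟨t, Finset.mem_singleton_self t, x, hx, htx⟩
    · rcases Finset.mem_insert.1 hx with rfl | hx
      · exact hst (conn_symm htx)
      · rw [Finset.mem_singleton] at hx
        subst hx
        exact hst (conn_symm (conn_trans htx h1))

omit [Fintype E] [DecidableEq E] [Fintype V] in
/-- (I2) `b(A₂,W₂)` is contained in the second left-hand event: `C_t` contains `v`, `C_s` hits
`A₂` and avoids `W₂`, `t` avoids `A₂ ∪ W₂ ∪ {s}`. -/
lemma bProp_subset (ends : E → Sym2 V) (s t v : V) (A₂ W₂ : Finset V) :
    ({ω | bProp ends s t v A₂ W₂ ω} : Set (Config E)) ⊆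
      clusterInEvent ends t {L | v ∈ L} ∩
        clusterInEvent ends s ({K | ∃ x ∈ A₂, x ∈ K} ∩ {K | ∀ x ∈ W₂, x ∉ K}) ∩
          avoidAll ends t (A₂ ∪ W₂ ∪ {s}) := by
  rintro ω ⟨h1, h2, h3, h4, _⟩
  refine ⟨⟨conn_symm h1, ?_, ?_⟩, ?_⟩
  · obtain ⟨x, hx, hsx⟩ := connSet_singleton_left.1 h2
    exact ⟨x, hx, hsx⟩
  · intro x hx hsx
    exact h4 ⟨s, Finset.mem_singleton_self s, x, hx, hsx⟩
  · intro x hx htx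
    refine h3 ⟨t, Finset.mem_singleton_self t, x, ?_, htx⟩
    simp only [Finset.mem_union, Finset.mem_singleton] at hx ⊢
    tauto

omit [Fintype E] [DecidableEq E] [Fintype V] in
/-- (I3) The first right-hand event of the corollary lies in `m(A₁ ∩ A₂, W₁ ∪ W₂)` when
`A₁ ∩ A₂ = ∅`. -/
lemma subset_mProp (ends : E → Sym2 V) (s t v : V) (A₁ W₁ A₂ W₂ : Finset V)
    (hA : ∀ x, x ∈ A₁ → x ∈ A₂ → False) :
    clusterInEvent ends t ({L | ∃ y ∈ W₁, y ∈ L} ∩ {L | v ∈ L}) ∩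
        clusterInEvent ends s ({K | ∀ x ∈ A₁ ∪ W₁, x ∉ K} ∩ {K | ∀ x ∈ W₂, x ∉ K}) ∩
          avoidAll ends t ((A₁ ∪ {s, v}) ∩ (A₂ ∪ W₂ ∪ {s})) ⊆
      ({ω | mProp ends s t v (A₁ ∩ A₂) (W₁ ∪ W₂) ω} : Set (Config E)) := by
  rintro ω ⟨⟨⟨⟨y, hy, hty⟩, htv⟩, hW₁, hW₂⟩, hav⟩
  have hts : ¬ Conn ends ω t s := hav s (by simp)
  refine ⟨⟨t, Finset.mem_singleton_self t, y, Finset.mem_union_left _ hy, hty⟩,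
    ⟨v, Finset.mem_singleton_self v, t, Finset.mem_union_left _ (Finset.mem_singleton_self t),
      conn_symm htv⟩, ?_, ?_⟩
  · rintro ⟨s', hs', x, hx, hsx⟩
    rw [Finset.mem_singleton] at hs'
    subst hs'
    simp only [Finset.mem_union, Finset.mem_singleton, Finset.mem_inter] at hx
    rcases hx with (rfl | ⟨hx1, _⟩) | hx | hx
    · exact hts (conn_symm hsx)
    · exact hW₁ x (Finset.mem_union_left _ hx1) hsx
    · exact hW₁ x (Finset.mem_union_right _ hx) hsx
    · exact hW₂ x hx hsx
  · rintro ⟨_, _, x, hx, _⟩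
    exact hA x (Finset.mem_inter.1 hx).1 (Finset.mem_inter.1 hx).2

omit [Fintype E] [DecidableEq E] [Fintype V] in
/-- (I4) The second right-hand event of the corollary lies in `j(A₁ ∪ A₂, W₁ ∩ W₂)` when
`W₁ ∩ W₂ = ∅`. -/
lemma subset_jProp (ends : E → Sym2 V) (s t v : V) (A₁ W₁ A₂ W₂ : Finset V)
    (hW : ∀ x, x ∈ W₁ → x ∈ W₂ → False) :
    clusterInEvent ends s ({K | v ∈ K} ∩ {K | ∃ x ∈ A₂, x ∈ K}) ∩
        avoidAll ends t ((A₁ ∪ {s, v}) ∪ (A₂ ∪ W₂ ∪ {s})) ⊆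
      ({ω | jProp ends s t v (A₁ ∪ A₂) (W₁ ∩ W₂) ω} : Set (Config E)) := by
  rintro ω ⟨⟨hsv, x, hx, hsx⟩, hav⟩
  refine ⟨⟨s, Finset.mem_singleton_self s, x, Finset.mem_union_right _ hx, hsx⟩,
    ⟨v, Finset.mem_singleton_self v, s, Finset.mem_union_left _ (Finset.mem_singleton_self s),
      conn_symm hsv⟩, ?_, ?_⟩
  · rintro ⟨t', ht', y, hy, hty⟩
    rw [Finset.mem_singleton] at ht'
    subst ht'
    refine hav y ?_ hty
    simp only [Finset.mem_union, Finset.mem_singleton, Finset.mem_inter, Finset.mem_insert] at hy ⊢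
    tauto
  · rintro ⟨_, _, y, hy, _⟩
    exact hW y (Finset.mem_inter.1 hy).1 (Finset.mem_inter.1 hy).2

/-- The base case `Z = ∅`: the two-cluster four-functions corollary of the antitone BHK theorem
(`bhk_two_cluster_four'`, explored root `t`) on the whole graph with the edges outside `U`
pinned closed. -/
theorem vfamily_base (p : E → R) (hp : IsProbVec p) (ends : E → Sym2 V) (s t v : V)
    (U : Finset V) (A₁ W₁ A₂ W₂ : Finset V) (hZ : (A₁ ∪ W₁) ∩ (A₂ ∪ W₂) = ∅) :
    prob p (aEv ends U s t v A₁ W₁) * prob p (bEv ends U s t v A₂ W₂) ≤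
      prob p (jEv ends U s t v (A₁ ∪ A₂) (W₁ ∩ W₂)) *
        prob p (mEv ends U s t v (A₁ ∩ A₂) (W₁ ∪ W₂)) := by
  have hq := isProbVec_pinU hp ends U
  have hA : ∀ x, x ∈ A₁ → x ∈ A₂ → False := fun x h1 h2 =>
    Finset.notMem_empty x (hZ ▸ Finset.mem_inter.2
      ⟨Finset.mem_union_left _ h1, Finset.mem_union_left _ h2⟩)
  have hW : ∀ x, x ∈ W₁ → x ∈ W₂ → False := fun x h1 h2 =>
    Finset.notMem_empty x (hZ ▸ Finset.mem_inter.2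
      ⟨Finset.mem_union_right _ h1, Finset.mem_union_right _ h2⟩)
  rw [aEv_eq_induced_mem, bEv_eq_induced_mem, jEv_eq_induced_mem, mEv_eq_induced_mem,
    prob_induced_eq_prob_pinU, prob_induced_eq_prob_pinU, prob_induced_eq_prob_pinU,
    prob_induced_eq_prob_pinU]
  have key := BHKAntitoneCross.bhk_two_cluster_four' (pinU p ends U) hq ends t s (X := A₁ ∪ {s, v})
    (Y := A₂ ∪ W₂ ∪ {s}) (by simp) (by simp)
    (𝓤₁ := {L | ∃ y ∈ W₁, y ∈ L}) (𝓤₂ := {L | v ∈ L}) (𝓥₁ := {K | v ∈ K})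
    (𝓥₂ := {K | ∃ x ∈ A₂, x ∈ K}) (𝓦₁ := {K | ∀ x ∈ A₁ ∪ W₁, x ∉ K})
    (𝓦₂ := {K | ∀ x ∈ W₂, x ∉ K})
    (fun _ _ h ⟨y, hy, hyL⟩ => ⟨y, hy, h hyL⟩) (fun _ _ h hv => h hv) (fun _ _ h hv => h hv)
    (fun _ _ h ⟨x, hx, hxK⟩ => ⟨x, hx, h hxK⟩) (fun _ _ h hK x hx hxK => hK x hx (h hxK))
    (fun _ _ h hK x hx hxK => hK x hx (h hxK))
  refine le_trans (mul_le_mul (prob_mono hq (aProp_subset ends s t v A₁ W₁))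
    (prob_mono hq (bProp_subset ends s t v A₂ W₂)) (prob_nonneg hq _) (prob_nonneg hq _)) ?_
  refine le_trans key ?_
  rw [mul_comm (prob (pinU p ends U) {ω | jProp ends s t v (A₁ ∪ A₂) (W₁ ∩ W₂) ω})]
  exact mul_le_mul (prob_mono hq (subset_mProp ends s t v A₁ W₁ A₂ W₂ hA))
    (prob_mono hq (subset_jProp ends s t v A₁ W₁ A₂ W₂ hW)) (prob_nonneg hq _) (prob_nonneg hq _)

end Base

end BTVFamily

end Summit.Ventures.PercRepro2
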